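import Summits.ValiantsHypothesis.ValiantsHypothesis.Theorems.KPlusLogSqLawStaticTridiagonalWeight
import Summits.ValiantsHypothesis.ValiantsHypothesis.Theorems.KPlusLogSqLawStaticTridiagonalPermDefs
import Summits.ValiantsHypothesis.ValiantsHypothesis.Theorems.KPlusLogSqLawStaticPathChain

/-!
# Route «KPlusLogSqLaw» — dominant chains of a full STATIC TRIDIAGONAL design have `O(m log m)` terms (conditional on non-degeneracy)

HONEST FRAMING.  Helper toward the crux `WeakLifting` (item `stmt-ValiantsHypothesis-19561`, route `KPlusLogSqLaw`, cell `pub-symmetroid`,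
seat val-sym-lift-p3 g6, 2026-08-27) on the line of its witness-plan stub `stub_tridiagonalSectorB`: the TROPICAL side of the STATIC
tridiagonal sub-sector.  In the tree's own vocabulary (`IsDominant`, `termSign`, `tropWeight` of `MatrixDescartesFalseOfTropicalMonster.lean`):
for a dominance design `(d, v, ε)` of format `(m, K)` that is FULL STATIC TRIDIAGONAL — an entry `(i, j)` carries a class iff `|i − j| ≤ 1`, and
then exactly the one class `cls i j` (`hε`) — every chain of DISTINCT consecutive dominant terms at strictly increasing integer slopes has at most
`66 · (m−1) · (⌊log₂ (m−1)⌋ + 2)` steps (`StaticTridiagonal.chain_le_of_static_tridiagonal`), PROVIDED the item lines of the design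
(`itemSlope`, `itemIcpt`: off-diagonal pair minus the two diagonals of each adjacent transposition) have no identically vanishing alternating
interval sum (`hG`) — the non-degeneracy hypothesis of the kernel static-path law `StaticPathFold.chain_le`, to be discharged by scaling and
perturbing the valuations (step (T5) of HOME/val-sym-lift-p3/g6/FOLD-LEMMA-AND-WIDTH2-TRELLIS-liftp3g6.md §A2; not done here).  No sign
hypothesis is used (only distinctness of consecutive terms, which the alternation of `TropRootLawAt` chains implies).  Compare the sector's known
law `IntervalOpt.chain_le_banded` (polynomial, `(mK+1)(2m)^5` at bandwidth one) and `tropicalB_hessenberg`.  Nothing here asserts anything about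
`WeakLifting`, `TropicalB`, `KPlusLogSqLaw`, the stub in its window, `MatrixDescartes` (stmt-ValiantsHypothesis-18050) or `VP ≠ VNP`.
-/

set_option linter.dupNamespace false
set_option autoImplicit false

namespace Summit.ValiantsHypothesis.ValiantsHypothesis.Theorems.KPlusLogSqLaw

open Finset Classical
open Summit.ValiantsHypothesis.ValiantsHypothesis.Theorems.MatrixDescartes.Negative

namespace StaticTridiagonal

noncomputable section

variable {m K : ℕ}

/-! ## 1. The involution of a path matching -/

section SwapFun

/-- bounds of the items. [folklore] -/
theorem item_bounds {S : Finset ℕ} (hS : S ⊆ Ioc 0 (m - 1)) {t : ℕ} (ht : t ∈ S) : 1 ≤ t ∧ t ≤ m - 1 := by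
  have := mem_Ioc.mp (hS ht); exact ⟨this.1, this.2⟩

/-- the matching map stays below `m`. [folklore] -/
theorem swapFunN_lt {S : Finset ℕ} (hS : S ⊆ Ioc 0 (m - 1)) {c : ℕ} (hc : c < m) : swapFunN S c < m := by
  unfold swapFunN
  split_ifs with h1 h2
  · have := item_bounds hS h1; omega
  · omega
  · exact hc

/-- the matching map moves points by at most one. [folklore] -/
theorem swapFunN_band (S : Finset ℕ) (c : ℕ) : swapFunN S c ≤ c + 1 ∧ c ≤ swapFunN S c + 1 := by
  unfold swapFunN
  split_ifs <;> omega

/-- the matching map is an involution. [folklore] -/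
theorem swapFunN_invol {S : Finset ℕ} (hS : S ⊆ Ioc 0 (m - 1)) (hI : ∀ t ∈ S, t + 1 ∉ S) (c : ℕ) :
    swapFunN S (swapFunN S c) = c := by
  by_cases h1 : c + 1 ∈ S
  · have h2 : c + 1 + 1 ∉ S := hI _ h1
    have e1 : swapFunN S c = c + 1 := by unfold swapFunN; rw [if_pos h1]
    rw [e1]; unfold swapFunN; rw [if_neg h2, if_pos h1]; omega
  · by_cases h3 : c ∈ S
    · have hb := item_bounds hS h3
      have e1 : swapFunN S c = c - 1 := by unfold swapFunN; rw [if_neg h1, if_pos h3]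
      rw [e1]; unfold swapFunN
      have : c - 1 + 1 = c := by omega
      rw [this, if_pos h3]
    · have e1 : swapFunN S c = c := by unfold swapFunN; rw [if_neg h1, if_neg h3]
      rw [e1, e1]

/-- `c + 1 ∈ S` iff the matching map sends `c` to `c + 1`. [folklore] -/
theorem swapFunN_eq_succ_iff {S : Finset ℕ} (hS : S ⊆ Ioc 0 (m - 1)) (c : ℕ) : swapFunN S c = c + 1 ↔ c + 1 ∈ S := by
  unfold swapFunN
  split_ifs with h1 h2
  · exact ⟨fun _ => h1, fun _ => rfl⟩
  · have := item_bounds hS h2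
    exact ⟨fun h => absurd h (by omega), fun h => absurd h h1⟩
  · exact ⟨fun h => absurd h (by omega), fun h => absurd h h1⟩

end SwapFun

/-! ## 2. Band terms are determined by their swap sets -/

/-- for a bandwidth-one permutation, `extN σ` is the matching map of its swap set. [folklore] -/
theorem extN_eq_swapFunN {σ : Equiv.Perm (Fin m)} (hb : ∀ u : Fin m, (σ u : ℕ) ≤ u + 1 ∧ (u : ℕ) ≤ σ u + 1) {c : ℕ}
    (hc : c < m) : extN σ c = swapFunN (swapSet σ) c := by
  unfold swapFunN
  rcases extN_trichotomy hb hc with h | h | h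
  · -- fixed: neither `c + 1` nor `c` is an item
    have h1 : c + 1 ∉ swapSet σ := fun hm => by
      have := (mem_swapSet.mp hm).2; rw [Nat.add_sub_cancel] at this; omega
    have h2 : c ∉ swapSet σ := fun hm => by
      obtain ⟨⟨hc1, _⟩, h3⟩ := mem_swapSet.mp hm
      have h4 := extN_extN hb (t := c - 1) (by omega)
      rw [h3, h] at h4; omega
    rw [if_neg h1, if_neg h2, h]
  · -- opener
    have h1 : c + 1 ∈ swapSet σ := by
      rw [mem_swapSet, Nat.add_sub_cancel]
      have := extN_lt σ hc
      exact ⟨⟨by omega, by omega⟩, h⟩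
    rw [if_pos h1, h]
  · -- closer: `c ∈ swapSet`, `c + 1 ∉ swapSet`
    have hc1 : 1 ≤ c := by omega
    have h1 : c + 1 ∉ swapSet σ := fun hm => by
      have := (mem_swapSet.mp hm).2; rw [Nat.add_sub_cancel] at this; omega
    have h2 : c ∈ swapSet σ := by
      rw [mem_swapSet]
      have h4 := extN_extN hb hc
      have e : extN σ c = c - 1 := by omega
      rw [e] at h4
      exact ⟨⟨hc1, by omega⟩, h4⟩
    rw [if_neg h1, if_pos h2]; omega

/-- two bandwidth-one permutations with the same swap set are equal. [folklore] -/
theorem perm_eq_of_swapSet_eq {σ σ' : Equiv.Perm (Fin m)} (hb : ∀ u : Fin m, (σ u : ℕ) ≤ u + 1 ∧ (u : ℕ) ≤ σ u + 1)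
    (hb' : ∀ u : Fin m, (σ' u : ℕ) ≤ u + 1 ∧ (u : ℕ) ≤ σ' u + 1) (h : swapSet σ = swapSet σ') : σ = σ' := by
  refine Equiv.ext fun c => Fin.ext ?_
  have e1 := extN_eq_swapFunN hb c.isLt
  have e2 := extN_eq_swapFunN hb' c.isLt
  rw [extN_val] at e1 e2
  rw [e1, e2, h]

/-! ## 3. The chain bound -/

/-- presence in a full static tridiagonal design forces bandwidth one and the class table. [folklore] -/
theorem band_and_cls_of_termSign_ne_zero {ε : Fin m → Fin m → Fin K → ℤ} {cls : Fin m → Fin m → Fin K}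
    (hε : ∀ i j l, ε i j l ≠ 0 ↔ (((i : ℕ) ≤ j + 1 ∧ (j : ℕ) ≤ i + 1) ∧ l = cls i j))
    {p : Equiv.Perm (Fin m) × (Fin m → Fin K)} (hp : termSign ε p ≠ 0) :
    (∀ u : Fin m, (p.1 u : ℕ) ≤ u + 1 ∧ (u : ℕ) ≤ p.1 u + 1) ∧ ∀ c, p.2 c = cls (p.1 c) c := by
  unfold termSign at hp
  have hprod : ∏ i, ε (p.1 i) i (p.2 i) ≠ 0 := fun h => hp (by rw [h, mul_zero])
  rw [Finset.prod_ne_zero_iff] at hprod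
  refine ⟨fun u => ?_, fun c => ?_⟩
  · exact ((hε _ _ _).mp (hprod u (mem_univ u))).1
  · exact ((hε _ _ _).mp (hprod c (mem_univ c))).2

/-- **DOMINANT CHAINS OF A FULL STATIC TRIDIAGONAL DESIGN HAVE `O(m log m)` TERMS** (conditional on the non-degeneracy of its item lines).
[folklore] -/
theorem chain_le_of_static_tridiagonal (d : Fin K → ℕ) (v ε : Fin m → Fin m → Fin K → ℤ) (cls : Fin m → Fin m → Fin K)
    (hε : ∀ i j l, ε i j l ≠ 0 ↔ (((i : ℕ) ≤ j + 1 ∧ (j : ℕ) ≤ i + 1) ∧ l = cls i j))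
    (hG : ∀ u w : ℕ, u < w → w ≤ m - 1 →
      (∑ t ∈ Finset.Ioc u w, (-1 : ℝ) ^ t * itemSlope cls d t ≠ 0 ∨ ∑ t ∈ Finset.Ioc u w, (-1 : ℝ) ^ t * itemIcpt cls v t ≠ 0))
    (n : ℕ) (θ : Fin (n + 1) → ℤ) (p : Fin (n + 1) → Equiv.Perm (Fin m) × (Fin m → Fin K)) (hθ : StrictMono θ)
    (hdom : ∀ k, IsDominant d v ε (θ k) (p k)) (hne : ∀ k : Fin n, p k.castSucc ≠ p k.succ) :
    n ≤ 66 * (m - 1) * (Nat.log 2 (m - 1) + 2) := by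
  -- bandwidth one and the class table along the chain
  have hbc : ∀ k, (∀ u : Fin m, ((p k).1 u : ℕ) ≤ u + 1 ∧ (u : ℕ) ≤ (p k).1 u + 1) ∧ ∀ c, (p k).2 c = cls ((p k).1 c) c :=
    fun k => band_and_cls_of_termSign_ne_zero hε (hdom k).1
  -- the item lines and the path framework on items `1, …, m-1`
  set w₁ : ℕ → ℝ := itemSlope cls d with hw₁
  set w₀ : ℕ → ℝ := itemIcpt cls v with hw₀
  have hW : ∀ t (x : ℝ), StaticPathFold.W w₁ w₀ t x = itemSlope cls d t * x + itemIcpt cls v t := fun t x => rfl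
  refine StaticPathFold.chain_le w₁ w₀ 0 (m - 1) (fun u w _ huw hw => hG u w huw (by omega)) n (fun k => (θ k : ℝ))
    (fun a b hab => by show ((θ a : ℤ) : ℝ) < ((θ b : ℤ) : ℝ); exact_mod_cast hθ hab) (fun k => swapSet (p k).1) ?_ ?_ ?_
  · -- swap sets are independent sets of the block
    intro k
    rw [StaticPathFold.mem_indepSets, Nat.zero_add]
    exact swapSet_indep (hbc k).1
  · -- uniqueness: every other independent set is the swap set of a present band term, beaten by dominance
    intro k S hS hSne
    rw [StaticPathFold.mem_indepSets, Nat.zero_add] at hS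
    obtain ⟨hSsub, hSind⟩ := hS
    -- the permutation of `S`
    have hm : 0 < m := by
      rcases Nat.eq_zero_or_pos m with h0 | h0
      · -- `m = 0`: every independent set is empty, and so is every swap set
        exfalso; subst h0
        apply hSne
        have e1 : S = ∅ := subset_empty.mp (by intro t ht; have := mem_Ioc.mp (hSsub ht); omega)
        have e2 : swapSet (p k).1 = ∅ := subset_empty.mp (by
          intro t ht; have := (mem_swapSet.mp ht).1; omega)
        rw [e1, e2]
      · exact h0
    let f : Fin m → Fin m := fun c => ⟨swapFunN S c, swapFunN_lt hSsub c.isLt⟩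
    have hfinv : Function.Involutive f := fun c => Fin.ext (swapFunN_invol hSsub hSind c)
    let σS : Equiv.Perm (Fin m) := hfinv.toPerm f
    have hσS : ∀ c : Fin m, ((σS c : Fin m) : ℕ) = swapFunN S c := fun c => rfl
    have hbS : ∀ u : Fin m, (σS u : ℕ) ≤ u + 1 ∧ (u : ℕ) ≤ σS u + 1 := fun u => by
      rw [hσS]; exact swapFunN_band S u
    have hswapS : swapSet σS = S := by
      ext t
      rw [mem_swapSet]
      constructor
      · rintro ⟨⟨h1, h2⟩, h3⟩
        rw [extN_of_lt σS (by omega), hσS] at h3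
        have := (swapFunN_eq_succ_iff hSsub (t - 1)).mp (by rw [h3]; omega)
        rwa [show t - 1 + 1 = t by omega] at this
      · intro ht
        have hb := item_bounds hSsub ht
        refine ⟨⟨hb.1, hb.2⟩, ?_⟩
        rw [extN_of_lt σS (by omega), hσS]
        have := (swapFunN_eq_succ_iff hSsub (t - 1)).mpr (by rwa [show t - 1 + 1 = t by omega])
        rw [this]; omega
    -- the present term of `S`
    let pS : Equiv.Perm (Fin m) × (Fin m → Fin K) := (σS, classOf cls σS)
    have hpres : termSign ε pS ≠ 0 := by
      unfold termSign
      refine mul_ne_zero (by exact_mod_cast (Equiv.Perm.sign σS).ne_zero) ?_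
      rw [Finset.prod_ne_zero_iff]
      intro c _
      exact (hε _ _ _).mpr ⟨hbS c, rfl⟩
    have hpne : pS ≠ p k := by
      intro he
      apply hSne
      rw [← hswapS, show σS = (p k).1 from congrArg Prod.fst he]
    -- dominance and the weight decomposition
    have hlt := (hdom k).2 pS hpne hpres
    have hlt' : (tropWeight d v (θ k) pS : ℝ) < (tropWeight d v (θ k) (p k) : ℝ) := by exact_mod_cast hlt
    have e1 := tropWeight_eq_diag_add_items cls d v (θ k) σS (classOf cls σS) hbS (fun c => rfl)
    have e2 := tropWeight_eq_diag_add_items cls d v (θ k) (p k).1 (p k).2 (hbc k).1 (hbc k).2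
    rw [show pS = (σS, classOf cls σS) from rfl, e1] at hlt'
    rw [show p k = ((p k).1, (p k).2) from rfl] at hlt'
    rw [e2, hswapS] at hlt'
    simp only [hW]
    linarith
  · -- consecutive swap sets differ
    intro e heq
    apply hne e
    have hσ : (p e.castSucc).1 = (p e.succ).1 := perm_eq_of_swapSet_eq (hbc _).1 (hbc _).1 heq
    refine Prod.ext hσ (funext fun c => ?_)
    rw [(hbc e.castSucc).2 c, (hbc e.succ).2 c, hσ]

end

end StaticTridiagonal

end Summit.ValiantsHypothesis.ValiantsHypothesis.Theorems.KPlusLogSqLaw
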